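import Summits.BirchSwinnertonDyer.BirchSwinnertonDyer.Theorems.ManinLocalTwoThreeAnalyticBridge
import Summits.BirchSwinnertonDyer.BirchSwinnertonDyer.Theorems.ManinLocalTwoThreeNeronSqueeze
import HarnessLib

/-!
# The ratio bridge: a Weierstrass equation for `x = A/B` OFF THE ZEROS OF `B` puts `Λ(f)` inside `Λ`

Cell bsd-f2-manin, route `ManinLocalTwoThree` (cruxes C2 `ManinOddAtFour`, C3 `ManinPrimeToThreeAtNine`),
planner seat -an gen 52 (TURNKEY node; fact-free, standard axioms).

The tree's analytic bridge `AnalyticBridge.periodLattice_le_of_deriv_sq` asks for a HOLOMORPHIC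
`Γ₀(N)`-invariant `x : ℍ → ℂ` with `x′² = (2πif)²(4x³ − g₂x − g₃)`; at the levels `27, 32, 36, 40, 48, 64, …`
such an `x` is an `η`-quotient (Ligozat).  At `63a1`, `80a1`, … the pull-back `x∘φ` of the Weierstrass
coordinate has poles at NON-CUSPIDAL points of `φ⁻¹(O)` and no `η`-quotient can serve.  But the tree's
uniqueness theorem for the Weierstrass equation (`PeriodPair.exists_eq_weierstrassP_of_deriv_sq`,
Whittaker–Watson §20.22) is already stated on `C ∖ T` with `T` countable, so the bridge holds OFF ANY
COUNTABLE `Γ₀(N)`-STABLE CLOSED SET: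

* §1 `cuspSymbol_mem_of_deriv_sq_off`, `periodLattice_le_of_deriv_sq_off` — `x` analytic on an open
  `Γ₀(N)`-stable `V ⊆ ℍ` with countable complement, the equation on `V`, `Γ₀(N)`-invariance on `V`,
  `4x³ − g₂x − g₃ ≠ 0` somewhere on `V` ⟹ `Λ(f) ⊆ Λ`.
* §2 **THE RATIO BRIDGE** `periodLattice_le_of_bracket_sq` — `A, B : ℍ → ℂ` holomorphic with a COMMON
  automorphy factor `J` on `Γ₀(N)` (`A(γτ) = J_γ(τ)A(τ)`, `B(γτ) = J_γ(τ)B(τ)`, `J_γ(τ) ≠ 0`; any weight, any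
  multiplier system) and the BRACKET IDENTITY of holomorphic functions on `ℍ`
  `(A′B − AB′)² = (2πi f)² · (4A³ − g₂AB² − g₃B³) · B`, non-degenerate at one point
  (`B ≠ 0`, `4A³ − g₂AB² − g₃B³ ≠ 0`) ⟹ `Λ(f) ⊆ Λ` (apply §1 to `x = A/B` on `V = {B ≠ 0}`).
  §2b the weight-`k` form `periodLattice_le_of_bracket_sq_of_weight` (`J_γ(τ) = (cτ + d)^k`, e.g. sums of
  `η`-quotients with `NewmanCond N r k`, `etaQuotient_smul_of_mem_Gamma0`).
* §3 with p3's Néron squeeze: `abs_maninConstant_eq_one_of_bracketIdentity`,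
  `not_dvd_maninConstant_of_bracketIdentity` — for an `X₀(N)`-datum `D` of a globally minimal `W` with the
  lattice clause, ONE bracket identity for `(D.f, c₄(W₀)/12, c₆(W₀)/216)` with `W₀` globally minimal gives
  `|c(D)| = 1`, so no prime divides `c(D)`.

WHY: `x∘φ = ℘_Λ(ℰ_f)` (`ℰ_f = 2πi∫f`) is a meromorphic function on `X₀(N)`, hence a ratio `A/B` of two
modular forms of one weight `k` (for `k = 2` as soon as `dim M₂(Γ₀(N)) > 2 deg φ`, which holds at every level
`≤ 144` of the C2/C3 census); the certificate of (S2) `Λ(f) ⊆ Λ_{W₀}` is then ONE polynomial identity in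
`M_{4k+4}(Γ₀(N))` (Sturm bound `(4k+4)μ₀(N)/12`), with no modular-unit luck, no `y`-coordinate and no cusp
analysis.  Exact data (`A`, `B` in the `η`-basis of `M₂(Γ₀(N))`, identity verified beyond the Sturm bound in
exact arithmetic) for `40a, 52a, 63a, 80a, 80b, …`: seat folder `scripts/ratiocoords.py`, table
`RATIO-COORDS-v1` (HOME/an/g52/).

HONEST FRAMING: fact-free, standard axioms; nothing here proves C2/C3 for all `N`, Manin's conjecture or BSD.
[cite: Manin1972, Prop. 1.4] [cite: WhittakerWatson1927, §20.22] [cite: CremonaAlgorithms1997, §2.10]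
-/

set_option autoImplicit false
set_option linter.dupNamespace false

noncomputable section

open Complex Filter Topology Set Function
open UpperHalfPlane hiding I
open scoped Real Topology Manifold MatrixGroups ModularForm PeriodPair
open CongruenceSubgroup
open Literature.NumberTheory.EllipticCurves Literature.NumberTheory.EllipticCurves.ModularForms

namespace Summit.BirchSwinnertonDyer.BirchSwinnertonDyer.Theorems.ManinLocalTwoThree.RatioBridge

open AnalyticBridge

variable {N : ℕ} [NeZero N]

/-! ## §1 The analytic bridge off a countable `Γ₀(N)`-stable set -/

/-- **Off-poles cusp-symbol lemma.**  Let `V ⊆ ℍ` be open with countable complement in `ℍ` and stable under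
`γ ∈ Γ₀(N)`, `x` analytic on `V` with `x′² = (2πif)²(4x³ − g₂x − g₃)` on `V`, `4x³ − g₂x − g₃ ≠ 0` at a point of
`V`, and `x(γτ) = x(τ)` for `τ ∈ V`.  Then the cusp symbol `{∞, γ∞}_f` lies in `Λ`. [cite: Manin1972, Prop. 1.4] -/
theorem cuspSymbol_mem_of_deriv_sq_off (f : CuspForm (Gamma0 N) 2) (hf : f ≠ 0) (L : PeriodPair)
    (V : Set ℂ) (hVo : IsOpen V) (hVsub : V ⊆ {z : ℂ | 0 < z.im}) (hVc : ({z : ℂ | 0 < z.im} \ V).Countable)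
    (x : ℂ → ℂ) (hx : AnalyticOnNhd ℂ x V)
    (hode : ∀ z ∈ V, ∀ hz : 0 < z.im, deriv x z ^ 2 =
      (2 * π * Complex.I * f ⟨z, hz⟩) ^ 2 * (4 * x z ^ 3 - L.g₂ * x z - L.g₃))
    (hnd : ∃ z₀ ∈ V, 4 * x z₀ ^ 3 - L.g₂ * x z₀ - L.g₃ ≠ 0)
    (γ : Gamma0 N) (hVγ : ∀ τ : ℍ, (τ : ℂ) ∈ V → (((γ : SL(2, ℤ)) • τ : ℍ) : ℂ) ∈ V)
    (hγ : ∀ τ : ℍ, (τ : ℂ) ∈ V → x (((γ : SL(2, ℤ)) • τ : ℍ) : ℂ) = x τ) :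
    cuspSymbol f γ ∈ L.lattice := by
  set s : ℂ := cuspSymbol f γ with hs
  set v : ℂ → ℂ := fun w ↦ eichlerIntegral f (ofComplex w) with hv
  have hvan : AnalyticOnNhd ℂ v V := fun z hz ↦ analyticAt_eichlerIntegral_comp_ofComplex f (hVsub hz)
  have hode' : ∀ z ∈ V, deriv x z ^ 2 = deriv v z ^ 2 * (4 * x z ^ 3 - L.g₂ * x z - L.g₃) := by
    intro z hz
    have hz' : 0 < z.im := hVsub hz
    have hd : deriv v z = 2 * π * Complex.I * f ⟨z, hz'⟩ := by
      rw [hv, deriv_eichlerIntegral_comp_ofComplex f hz', ofComplex_apply_of_im_pos hz']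
    rw [hd]
    exact hode z hz hz'
  obtain ⟨w₀, hw₀V, h0⟩ := hnd
  obtain ⟨ε, hε, c, -, hglob⟩ := L.exists_eq_weierstrassP_of_deriv_sq convex_setOf_im_pos
    isOpen_upperHalfPlaneSet hVo hVsub hVc hx hvan hode' hw₀V h0
  have hε0 : ε ≠ 0 := by rcases hε with rfl | rfl <;> norm_num
  -- the curve `ζ = ε ℰ_f + c`
  set ζ : ℂ → ℂ := fun z ↦ ε * v z + c with hζ
  have hvγ : ∀ τ : ℍ, v (((γ : SL(2, ℤ)) • τ : ℍ) : ℂ) = v τ + s := by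
    intro τ
    simp only [hv, ofComplex_apply]
    linear_combination eichlerIntegral_smul_sub_holds f γ τ
  have hζγ : ∀ τ : ℍ, ζ (((γ : SL(2, ℤ)) • τ : ℍ) : ℂ) = ε * s + ζ τ := by
    intro τ
    simp only [hζ, hvγ]
    ring
  -- the pointwise translation symmetry on `V` off the poles
  have hpt : ∀ τ : ℍ, (τ : ℂ) ∈ V → ζ τ ∉ L.lattice → ε * s + ζ τ ∉ L.lattice →
      ℘[L] (ε * s + ζ τ) = ℘[L] (ζ τ) := by
    intro τ hτV h1 h2
    have e1 : x (((γ : SL(2, ℤ)) • τ : ℍ) : ℂ) = ℘[L] (ζ (((γ : SL(2, ℤ)) • τ : ℍ) : ℂ)) :=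
      hglob _ (hVγ τ hτV) (by show ζ _ ∉ L.lattice; rw [hζγ]; exact h2)
    have e2 : x τ = ℘[L] (ζ τ) := hglob _ hτV h1
    rw [← hζγ, ← e1, hγ τ hτV, e2]
  -- a good base point: in `V`, off the two countable lattice fibres
  have hbad : (({z : ℂ | 0 < z.im ∧ ε * eichlerIntegral f (ofComplex z) + c ∈ L.lattice} ∪
      {z : ℂ | 0 < z.im ∧ ε * eichlerIntegral f (ofComplex z) + (c + ε * s) ∈ L.lattice}) ∪
      ({z : ℂ | 0 < z.im} \ V)).Countable :=
    ((countable_setOf_eichlerIntegral_affine_mem f hf L hε0 c).union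
      (countable_setOf_eichlerIntegral_affine_mem f hf L hε0 (c + ε * s))).union hVc
  obtain ⟨z₀, hz₀V, hz₀1, hz₀2⟩ :
      ∃ z₀ : ℂ, z₀ ∈ V ∧ ζ z₀ ∉ L.lattice ∧ ε * s + ζ z₀ ∉ L.lattice := by
    by_contra hne
    push Not at hne
    apply not_countable_of_isOpen isOpen_upperHalfPlaneSet ⟨Complex.I, by simp⟩ (hbad.mono ?_)
    intro z hz
    by_cases hV : z ∈ V
    · by_cases h : ζ z ∈ L.lattice
      · exact Or.inl (Or.inl ⟨hz, h⟩)
      · refine Or.inl (Or.inr ⟨hz, ?_⟩)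
        have := hne z hV h
        simp only [hζ] at this
        convert this using 1
        ring
    · exact Or.inr ⟨hz, hV⟩
  have hz₀' : 0 < z₀.im := hVsub hz₀V
  -- the symmetry holds near `z₀`
  have hζc : ContinuousOn ζ V :=
    (continuousOn_const.mul
      ((differentiableOn_eichlerIntegral_comp_ofComplex f).continuousOn.mono hVsub)).add continuousOn_const
  have hO : IsOpen ((V ∩ ζ ⁻¹' (L.lattice : Set ℂ)ᶜ) ∩
      (V ∩ (fun z ↦ ε * s + ζ z) ⁻¹' (L.lattice : Set ℂ)ᶜ)) :=
    (hζc.isOpen_inter_preimage hVo L.isClosed_lattice.isOpen_compl).inter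
      ((continuousOn_const.add hζc).isOpen_inter_preimage hVo L.isClosed_lattice.isOpen_compl)
  have hev : ∀ᶠ z in 𝓝 z₀, ℘[L] (ε * s + ζ z) = ℘[L] (ζ z) := by
    filter_upwards [hO.mem_nhds ⟨⟨hz₀V, hz₀1⟩, ⟨hz₀V, hz₀2⟩⟩] with z hz
    exact hpt ⟨z, hVsub hz.1.1⟩ hz.1.1 hz.1.2 hz.2.2
  -- Manin's lemma
  have hζan : AnalyticAt ℂ ζ z₀ :=
    (analyticAt_const.mul (analyticAt_eichlerIntegral_comp_ofComplex f hz₀')).add analyticAt_const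
  have hζnc : ¬ ∀ᶠ z in 𝓝 z₀, ζ z = ζ z₀ := by
    intro h
    apply not_eventually_const_eichlerIntegral f hf hz₀' (v z₀)
    filter_upwards [h] with z hz
    simp only [hζ] at hz
    have := mul_left_cancel₀ hε0 (add_right_cancel hz)
    simpa [hv] using this
  have hmem : ε * s ∈ L.lattice :=
    L.mem_lattice_of_weierstrassP_comp_add_eventuallyEq hζan hζnc hz₀1 hz₀2 hev
  rcases hε with rfl | rfl
  · simpa using hmem
  · simpa using L.lattice.neg_mem hmem

/-- **The analytic bridge off a countable set.**  `V ⊆ ℍ` open, `Γ₀(N)`-stable, with countable complement;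
`x` analytic and `Γ₀(N)`-invariant on `V` with `x′² = (2πif)²(4x³ − g₂(Λ)x − g₃(Λ))` on `V` and
`4x³ − g₂x − g₃ ≢ 0` on `V`.  Then `Λ(f) ⊆ Λ`. [cite: Manin1972, Prop. 1.4] -/
theorem periodLattice_le_of_deriv_sq_off (f : CuspForm (Gamma0 N) 2) (hf : f ≠ 0) (L : PeriodPair)
    (V : Set ℂ) (hVo : IsOpen V) (hVsub : V ⊆ {z : ℂ | 0 < z.im}) (hVc : ({z : ℂ | 0 < z.im} \ V).Countable)
    (x : ℂ → ℂ) (hx : AnalyticOnNhd ℂ x V)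
    (hode : ∀ z ∈ V, ∀ hz : 0 < z.im, deriv x z ^ 2 =
      (2 * π * Complex.I * f ⟨z, hz⟩) ^ 2 * (4 * x z ^ 3 - L.g₂ * x z - L.g₃))
    (hnd : ∃ z₀ ∈ V, 4 * x z₀ ^ 3 - L.g₂ * x z₀ - L.g₃ ≠ 0)
    (hVΓ : ∀ (γ : Gamma0 N) (τ : ℍ), (τ : ℂ) ∈ V → (((γ : SL(2, ℤ)) • τ : ℍ) : ℂ) ∈ V)
    (hinv : ∀ (γ : Gamma0 N) (τ : ℍ), (τ : ℂ) ∈ V → x (((γ : SL(2, ℤ)) • τ : ℍ) : ℂ) = x τ) :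
    ∀ z ∈ periodLattice f, z ∈ L.lattice := by
  intro z hz
  induction hz using AddSubgroup.closure_induction with
  | mem y hy =>
    obtain ⟨γ, rfl⟩ := hy
    exact cuspSymbol_mem_of_deriv_sq_off f hf L V hVo hVsub hVc x hx hode hnd γ (hVΓ γ) (hinv γ)
  | zero => exact zero_mem _
  | add y y' _ _ hy hy' => exact add_mem hy hy'
  | neg y _ hy => exact neg_mem hy

/-! ## §2 The ratio bridge -/

/-- **THE RATIO BRIDGE.**  Let `f ≠ 0` in `S₂(Γ₀(N))`, `Λ` a period pair, `A, B : ℍ → ℂ` holomorphic with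
a common nowhere-vanishing automorphy factor `J` on `Γ₀(N)` (`A(γτ) = J_γ(τ)A(τ)`, `B(γτ) = J_γ(τ)B(τ)`),
and suppose the bracket identity `(A′B − AB′)² = (2πif)²(4A³ − g₂AB² − g₃B³)·B` holds on `ℍ` and
`B(τ₀) ≠ 0`, `4A³ − g₂AB² − g₃B³ ≠ 0` at one point `τ₀`.  Then `Λ(f) ⊆ Λ` — the analytic bridge for the
meromorphic `Γ₀(N)`-invariant function `x = A/B` off the countable zero set of `B`.
[cite: Manin1972, Prop. 1.4] [cite: WhittakerWatson1927, §20.22] -/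
theorem periodLattice_le_of_bracket_sq (f : CuspForm (Gamma0 N) 2) (hf : f ≠ 0) (L : PeriodPair)
    (A B : ℍ → ℂ) (hA : MDifferentiable 𝓘(ℂ) 𝓘(ℂ) A) (hB : MDifferentiable 𝓘(ℂ) 𝓘(ℂ) B)
    (J : Gamma0 N → ℍ → ℂ) (hJ : ∀ γ τ, J γ τ ≠ 0)
    (hAJ : ∀ (γ : Gamma0 N) (τ : ℍ), A ((γ : SL(2, ℤ)) • τ) = J γ τ * A τ)
    (hBJ : ∀ (γ : Gamma0 N) (τ : ℍ), B ((γ : SL(2, ℤ)) • τ) = J γ τ * B τ)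
    (hode : ∀ τ : ℍ, (deriv (A ∘ ofComplex) τ * B τ - A τ * deriv (B ∘ ofComplex) τ) ^ 2 =
      (2 * π * Complex.I * f τ) ^ 2 * (4 * A τ ^ 3 - L.g₂ * A τ * B τ ^ 2 - L.g₃ * B τ ^ 3) * B τ)
    (hnd : ∃ τ₀ : ℍ, B τ₀ ≠ 0 ∧ 4 * A τ₀ ^ 3 - L.g₂ * A τ₀ * B τ₀ ^ 2 - L.g₃ * B τ₀ ^ 3 ≠ 0) :
    ∀ z ∈ periodLattice f, z ∈ L.lattice := by
  set a : ℂ → ℂ := A ∘ ofComplex with ha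
  set b : ℂ → ℂ := B ∘ ofComplex with hb
  have hadiff : DifferentiableOn ℂ a {z : ℂ | 0 < z.im} := UpperHalfPlane.mdifferentiable_iff.mp hA
  have hbdiff : DifferentiableOn ℂ b {z : ℂ | 0 < z.im} := UpperHalfPlane.mdifferentiable_iff.mp hB
  have haz : ∀ τ : ℍ, a τ = A τ := fun τ ↦ by simp [ha, ofComplex_apply]
  have hbz : ∀ τ : ℍ, b τ = B τ := fun τ ↦ by simp [hb, ofComplex_apply]
  set V : Set ℂ := {z : ℂ | 0 < z.im} ∩ b ⁻¹' {0}ᶜ with hV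
  have hVo : IsOpen V :=
    hbdiff.continuousOn.isOpen_inter_preimage isOpen_upperHalfPlaneSet isOpen_compl_singleton
  have hVsub : V ⊆ {z : ℂ | 0 < z.im} := inter_subset_left
  have hmemV : ∀ {z : ℂ}, z ∈ V ↔ 0 < z.im ∧ b z ≠ 0 := fun {z} ↦ by
    simp [hV, mem_inter_iff, mem_preimage, mem_compl_iff, mem_singleton_iff]
  obtain ⟨τ₀, hB0, hcub0⟩ := hnd
  have hVc : ({z : ℂ | 0 < z.im} \ V).Countable := by
    have hconn : IsConnected {z : ℂ | 0 < z.im} := by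
      refine ⟨⟨Complex.I, by simp⟩, ?_⟩
      simpa using isPreconnected_diff_of_countable (T := ∅) convex_setOf_im_pos isOpen_upperHalfPlaneSet
        countable_empty
    have hban : AnalyticOnNhd ℂ b {z : ℂ | 0 < z.im} := hbdiff.analyticOnNhd isOpen_upperHalfPlaneSet
    have hne : b τ₀ ≠ 0 := by rwa [hbz]
    refine (countable_inter_preimage_singleton_of_analyticOnNhd hban hconn τ₀.im_pos hne).mono ?_
    intro z hz
    have hz1 : 0 < z.im := hz.1
    have hz2 : ¬ (0 < z.im ∧ b z ≠ 0) := fun h ↦ hz.2 (hmemV.mpr h)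
    refine ⟨hz1, ?_⟩
    simp only [mem_preimage, mem_singleton_iff]
    by_contra hbz0
    exact hz2 ⟨hz1, hbz0⟩
  set x : ℂ → ℂ := fun z ↦ a z / b z with hx
  have hxan : AnalyticOnNhd ℂ x V := by
    apply DifferentiableOn.analyticOnNhd _ hVo
    intro z hz
    have hz' := hmemV.mp hz
    exact (((hadiff z hz'.1).differentiableAt (isOpen_upperHalfPlaneSet.mem_nhds hz'.1)).div
      ((hbdiff z hz'.1).differentiableAt (isOpen_upperHalfPlaneSet.mem_nhds hz'.1)) hz'.2).differentiableWithinAt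
  have hode' : ∀ z ∈ V, ∀ hz : 0 < z.im, deriv x z ^ 2 =
      (2 * π * Complex.I * f ⟨z, hz⟩) ^ 2 * (4 * x z ^ 3 - L.g₂ * x z - L.g₃) := by
    intro z hzV hz
    have hbne : b z ≠ 0 := (hmemV.mp hzV).2
    have hda : DifferentiableAt ℂ a z := (hadiff z hz).differentiableAt (isOpen_upperHalfPlaneSet.mem_nhds hz)
    have hdb : DifferentiableAt ℂ b z := (hbdiff z hz).differentiableAt (isOpen_upperHalfPlaneSet.mem_nhds hz)
    have hd : deriv x z = (deriv a z * b z - a z * deriv b z) / b z ^ 2 := by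
      rw [hx]
      exact deriv_div hda hdb hbne
    have key := hode ⟨z, hz⟩
    have haz' : A ⟨z, hz⟩ = a z := by simp [ha, ofComplex_apply_of_im_pos hz]
    have hbz' : B ⟨z, hz⟩ = b z := by simp [hb, ofComplex_apply_of_im_pos hz]
    have hcoe : ((⟨z, hz⟩ : ℍ) : ℂ) = z := rfl
    rw [haz', hbz', hcoe] at key
    rw [hd, hx]
    simp only
    rw [div_pow, div_eq_iff (pow_ne_zero 2 (pow_ne_zero 2 hbne)), key]
    field_simp
  have hnd' : ∃ z₀ ∈ V, 4 * x z₀ ^ 3 - L.g₂ * x z₀ - L.g₃ ≠ 0 := by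
    refine ⟨τ₀, hmemV.mpr ⟨τ₀.im_pos, by rwa [hbz]⟩, ?_⟩
    have hbne : b τ₀ ≠ 0 := by rwa [hbz]
    rw [hx]
    simp only
    rw [haz, hbz] at *
    intro h
    apply hcub0
    have h' : (4 * (A τ₀ / B τ₀) ^ 3 - L.g₂ * (A τ₀ / B τ₀) - L.g₃) * B τ₀ ^ 3 = 0 := by
      rw [h, zero_mul]
    have : (4 * (A τ₀ / B τ₀) ^ 3 - L.g₂ * (A τ₀ / B τ₀) - L.g₃) * B τ₀ ^ 3 =
        4 * A τ₀ ^ 3 - L.g₂ * A τ₀ * B τ₀ ^ 2 - L.g₃ * B τ₀ ^ 3 := by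
      field_simp
    rwa [this] at h'
  have hVΓ : ∀ (γ : Gamma0 N) (τ : ℍ), (τ : ℂ) ∈ V → (((γ : SL(2, ℤ)) • τ : ℍ) : ℂ) ∈ V := by
    intro γ τ hτ
    refine hmemV.mpr ⟨((γ : SL(2, ℤ)) • τ).im_pos, ?_⟩
    rw [hbz, hBJ]
    exact mul_ne_zero (hJ γ τ) (by rw [← hbz]; exact (hmemV.mp hτ).2)
  have hinv : ∀ (γ : Gamma0 N) (τ : ℍ), (τ : ℂ) ∈ V → x (((γ : SL(2, ℤ)) • τ : ℍ) : ℂ) = x τ := by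
    intro γ τ hτ
    have hbne : B τ ≠ 0 := by rw [← hbz]; exact (hmemV.mp hτ).2
    simp only [hx, haz, hbz, hAJ, hBJ]
    rw [mul_div_mul_left _ _ (hJ γ τ)]
  exact periodLattice_le_of_deriv_sq_off f hf L V hVo hVsub hVc x hxan hode' hnd' hVΓ hinv

/-- **The ratio bridge, weight-`k` form**: `A, B` transform like weight-`k` forms on `Γ₀(N)`
(`A(γτ) = (cτ + d)^k A(τ)`, e.g. linear combinations of `η`-quotients with `NewmanCond N r k`, by
`etaQuotient_smul_of_mem_Gamma0`). [cite: Manin1972, Prop. 1.4] -/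
theorem periodLattice_le_of_bracket_sq_of_weight (f : CuspForm (Gamma0 N) 2) (hf : f ≠ 0) (L : PeriodPair)
    (A B : ℍ → ℂ) (hA : MDifferentiable 𝓘(ℂ) 𝓘(ℂ) A) (hB : MDifferentiable 𝓘(ℂ) 𝓘(ℂ) B) (k : ℤ)
    (hAk : ∀ (γ : Gamma0 N) (τ : ℍ),
      A ((γ : SL(2, ℤ)) • τ) = (((γ : SL(2, ℤ)) 1 0 : ℂ) * τ + ((γ : SL(2, ℤ)) 1 1 : ℂ)) ^ k * A τ)
    (hBk : ∀ (γ : Gamma0 N) (τ : ℍ),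
      B ((γ : SL(2, ℤ)) • τ) = (((γ : SL(2, ℤ)) 1 0 : ℂ) * τ + ((γ : SL(2, ℤ)) 1 1 : ℂ)) ^ k * B τ)
    (hode : ∀ τ : ℍ, (deriv (A ∘ ofComplex) τ * B τ - A τ * deriv (B ∘ ofComplex) τ) ^ 2 =
      (2 * π * Complex.I * f τ) ^ 2 * (4 * A τ ^ 3 - L.g₂ * A τ * B τ ^ 2 - L.g₃ * B τ ^ 3) * B τ)
    (hnd : ∃ τ₀ : ℍ, B τ₀ ≠ 0 ∧ 4 * A τ₀ ^ 3 - L.g₂ * A τ₀ * B τ₀ ^ 2 - L.g₃ * B τ₀ ^ 3 ≠ 0) :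
    ∀ z ∈ periodLattice f, z ∈ L.lattice :=
  periodLattice_le_of_bracket_sq f hf L A B hA hB
    (fun γ τ ↦ (((γ : SL(2, ℤ)) 1 0 : ℂ) * τ + ((γ : SL(2, ℤ)) 1 1 : ℂ)) ^ k)
    (fun γ τ ↦ zpow_ne_zero k (SL2_denom_ne_zero (γ : SL(2, ℤ)) τ)) hAk hBk hode hnd

/-! ## §3 With the Néron squeeze: `|c(D)| = 1` from one bracket identity -/

/-- The newform of an `X₀(N)`-datum is not zero (`a₁ = 1`). [folklore] -/
theorem f_ne_zero {W : WeierstrassCurve ℚ} (D : ModularParametrizationData W N) : D.f ≠ 0 := by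
  intro h0
  have h1 : cuspCoeff D.f 1 = (W.LFunction 1 : ℂ) := D.isNewformOf.2 1
  rw [W.isMultiplicative_LFunction.map_one, h0, cuspCoeff, CuspForm.coe_zero,
    UpperHalfPlane.qExpansion_zero, map_zero] at h1
  norm_num at h1

/-- **`|c(D)| = 1` from ONE bracket identity.**  Let `W₀/ℚ` be globally minimal with Néron period pair
`L₀` (`g₂ = c₄(W₀)/12`, `g₃ = c₆(W₀)/216`), `D` an `X₀(N)`-datum of a globally minimal `W/ℚ` with the lattice
clause `Λ_W = c·Λ(D.f)`, and `A, B : ℍ → ℂ` holomorphic of one weight `k` on `Γ₀(N)` satisfying the bracket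
identity `(A′B − AB′)² = (2πi·D.f)²(4A³ − g₂(L₀)AB² − g₃(L₀)B³)B`, non-degenerate at a point.  Then `|c(D)| = 1`.
[cite: AgasheRibetStein2006, §§1–2] [cite: CremonaAlgorithms1997, §2.10] -/
theorem abs_maninConstant_eq_one_of_bracketIdentity
    (W₀ : WeierstrassCurve ℚ) [W₀.IsElliptic] [W₀.IsGloballyMinimal] (L₀ : PeriodPair)
    (hL₀ : IsNeronLatticeOf (W₀.baseChange ℂ) L₀)
    (W : WeierstrassCurve ℚ) [W.IsElliptic] [W.IsGloballyMinimal] (D : ModularParametrizationData W N)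
    (hopt : ∀ z ∈ D.L.lattice, ∃ w ∈ periodLattice D.f, z = D.c * w)
    (A B : ℍ → ℂ) (hA : MDifferentiable 𝓘(ℂ) 𝓘(ℂ) A) (hB : MDifferentiable 𝓘(ℂ) 𝓘(ℂ) B) (k : ℤ)
    (hAk : ∀ (γ : Gamma0 N) (τ : ℍ),
      A ((γ : SL(2, ℤ)) • τ) = (((γ : SL(2, ℤ)) 1 0 : ℂ) * τ + ((γ : SL(2, ℤ)) 1 1 : ℂ)) ^ k * A τ)
    (hBk : ∀ (γ : Gamma0 N) (τ : ℍ),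
      B ((γ : SL(2, ℤ)) • τ) = (((γ : SL(2, ℤ)) 1 0 : ℂ) * τ + ((γ : SL(2, ℤ)) 1 1 : ℂ)) ^ k * B τ)
    (hode : ∀ τ : ℍ, (deriv (A ∘ ofComplex) τ * B τ - A τ * deriv (B ∘ ofComplex) τ) ^ 2 =
      (2 * π * Complex.I * D.f τ) ^ 2 * (4 * A τ ^ 3 - L₀.g₂ * A τ * B τ ^ 2 - L₀.g₃ * B τ ^ 3) * B τ)
    (hnd : ∃ τ₀ : ℍ, B τ₀ ≠ 0 ∧ 4 * A τ₀ ^ 3 - L₀.g₂ * A τ₀ * B τ₀ ^ 2 - L₀.g₃ * B τ₀ ^ 3 ≠ 0) :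
    |D.maninConstant| = 1 :=
  NeronSqueeze.abs_maninConstant_eq_one_of_periodLattice_le W₀ L₀ hL₀ W D
    (periodLattice_le_of_bracket_sq_of_weight D.f (f_ne_zero D) L₀ A B hA hB k hAk hBk hode hnd) hopt

/-- **No prime divides `c(D)`** under the hypotheses of `abs_maninConstant_eq_one_of_bracketIdentity` — the
shape of the conclusions of C2 (`2 ∤ c`, `p = 2`) and C3 (`3 ∤ c`, `p = 3`) at a level with a certified
bracket identity. [cite: AgasheRibetStein2006, §§1–2] -/
theorem not_dvd_maninConstant_of_bracketIdentity
    (W₀ : WeierstrassCurve ℚ) [W₀.IsElliptic] [W₀.IsGloballyMinimal] (L₀ : PeriodPair)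
    (hL₀ : IsNeronLatticeOf (W₀.baseChange ℂ) L₀)
    (W : WeierstrassCurve ℚ) [W.IsElliptic] [W.IsGloballyMinimal] (D : ModularParametrizationData W N)
    (hopt : ∀ z ∈ D.L.lattice, ∃ w ∈ periodLattice D.f, z = D.c * w)
    (A B : ℍ → ℂ) (hA : MDifferentiable 𝓘(ℂ) 𝓘(ℂ) A) (hB : MDifferentiable 𝓘(ℂ) 𝓘(ℂ) B) (k : ℤ)
    (hAk : ∀ (γ : Gamma0 N) (τ : ℍ),
      A ((γ : SL(2, ℤ)) • τ) = (((γ : SL(2, ℤ)) 1 0 : ℂ) * τ + ((γ : SL(2, ℤ)) 1 1 : ℂ)) ^ k * A τ)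
    (hBk : ∀ (γ : Gamma0 N) (τ : ℍ),
      B ((γ : SL(2, ℤ)) • τ) = (((γ : SL(2, ℤ)) 1 0 : ℂ) * τ + ((γ : SL(2, ℤ)) 1 1 : ℂ)) ^ k * B τ)
    (hode : ∀ τ : ℍ, (deriv (A ∘ ofComplex) τ * B τ - A τ * deriv (B ∘ ofComplex) τ) ^ 2 =
      (2 * π * Complex.I * D.f τ) ^ 2 * (4 * A τ ^ 3 - L₀.g₂ * A τ * B τ ^ 2 - L₀.g₃ * B τ ^ 3) * B τ)
    (hnd : ∃ τ₀ : ℍ, B τ₀ ≠ 0 ∧ 4 * A τ₀ ^ 3 - L₀.g₂ * A τ₀ * B τ₀ ^ 2 - L₀.g₃ * B τ₀ ^ 3 ≠ 0)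
    {p : ℤ} (hp : p.natAbs ≠ 1) : ¬ p ∣ D.maninConstant :=
  NeronSqueeze.not_dvd_maninConstant_of_periodLattice_le W₀ L₀ hL₀ W D
    (periodLattice_le_of_bracket_sq_of_weight D.f (f_ne_zero D) L₀ A B hA hB k hAk hBk hode hnd) hopt hp

end Summit.BirchSwinnertonDyer.BirchSwinnertonDyer.Theorems.ManinLocalTwoThree.RatioBridge

end
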